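import Literature.MathematicalPhysics.QuantumFieldTheory.Balaban1983to89.B8Eq155JBound

/-!
# `Balaban1983to89.B8ScaledSupNorm` — B8 p. 86: the multi-scale weighted supremum norms `|·|_(α)`
# over an admissible domain sequence `{Ω_j}_{j ≤ k}` (recalled in B8 from [4])

statement-level skeleton of published theorems with citation tags; proofs where landed; nothing here is a claim
about the Yang–Mills mass gap

CITATION HEADER (lean-in-tree rule 2026-08-18; mega-formalization `lit-balaban`, reader/typer seat r05, Phase 1
row `B8-C08` of `HOME/lit-balaban-r05/SKELETON-B8.md`).  T. Bałaban, *Spaces of regular gauge field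
configurations on a lattice and gauge fixing conditions*, Commun. Math. Phys. **99** (1985) 75–102
`[Balaban1985RegularSpaces]` ("B8"; journal page = PDF page + 74), p. 86 [PDF 12], the two sentences after (1.55),
read on the page render `1985-cmp99-regular-spaces-gauge-fixing-p012-x2.png` and the held text
`paper:balaban1985-cmp99-regular-spaces-gauge-fixing` p. 12:

> «|J|_(−3) ≤ 2α₀ + 36dα₂|∇^η_{U₀}A|_(−2) + 50dα₂³ + 10dα₀α₂, where the norms | |_(α) were introduced in [4].
> For the reader's convenience let us recall the definition: |A|_(α) = sup_j sup_{Ω_j} (Lʲη)^{−α}|A|.»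

([4] = T. Bałaban, *Propagators for lattice gauge theories in a background field*, Commun. Math. Phys. **99**
(1985) 389–434 `[Balaban1985BackgroundPropagators]` ("B9"), where the norms are (3.40)–(3.41) p. 397; in the tree
they are the ABSTRACT field `B9.Geometry.wNorm` and, inside B8's carriers, the abstract fields `B8.GFData.fNorm`
(`|f|_(−2)` of Theorem 8) and `B8.LandauData.lamNorm` (`max(|λ|, |Dλ|_(−1))` of Proposition 5).)

USES IN B8 (all printed with these norms): (1.55), (1.59)–(1.60) p. 86 (`|A|_(−1)`, `|∇^η_{U₀}A|_(−2)`,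
`|D^{η*}D^ηA|_(−3)`, `|Δ^ηA|_(−3)`, `|J|_(−3)`); (1.97)–(1.102), (1.105)–(1.106), (1.108)–(1.109) pp. 92–94
(`|λ|`, `|Dλ|_(−1)`, `|·|_(−2)`); Theorem 8 p. 101 (`|f|_(−2) < γ(α₀ + α₁)`); and, written out pointwise "on Ω_j",
(1.36), (1.39), (1.41), (1.62), (1.69), (1.77), (1.136), (1.140).

WHAT THE TREE ALREADY HAS (read first; nothing below restates it): `B8Eq155JBound.wsup w F = ⨆ i, w·‖F i‖` — the
weighted supremum AT ONE LEVEL over ALL indices (its HONEST SCOPE (ii): "THE NORMS ARE ONE-LEVEL AND GLOBAL: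
print's |·|_(α) is sup_j sup_{Ω_j} with the level-dependent weight (Lʲη)^{−α} over the sequence of domains (1.3)
… the multi-level norm is … NOT" typed there), with `jNorm3`, `gradNorm2` its instances for `J` and `∇^η_{U₀}A`.

WHAT IS TYPED HERE (definitions with bodies + kernel-checked API; no theorem of the paper is asserted):
* `msup L k η α mem F` — print's `sup_{j ≤ k} sup_{i "in" Ω_j} (Lʲη)^{−α}‖F i‖` for a family `F : ι → E` indexed by
  lattice objects `i` (sites, bonds, bond–direction pairs) with an abstract membership predicate `mem j i` ("i
  belongs to Ω_j" in the p. 77 sense: a bond/plaquette belongs to Ω if one of its end-points/corners does —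
  `B8Ineq132.BondTouches` / `PlaqTouches`); the weight is the real power `((L:ℝ)^j·η) ^ (−α)` (`α : ℝ`, as in [4]
  where `α = γ, 1+γ, 2+γ` occur; in B8 `α ∈ {0, −1, −2, −3}`);
* its API: `msup_le` (a pointwise bound on every `Ω_j`, `j ≤ k`, bounds the norm), `weight_mul_norm_le_msup`,
  `msup_nonneg`, `norm_le_of_msup_le` / `norm_lt_of_msup_lt` (the norm bound gives back the printed pointwise form
  `‖F i‖ ≤ c·(Lʲη)^{α}` on `Ω_j`), `weight_neg_natCast` (`(Lʲη)^{−(−n)} = (Lʲη)ⁿ`);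
* the three instances B8 uses on the `ℤᵈ` carriers of the lineage (`Site d = Fin d → ℤ`, bond fields
  `Site d → Fin d → E`): `siteNorm` (functions `λ`, `f` on sites: `x ∈ Ω_j`), `bondNorm` (bond functions `A`, `J`,
  `Dλ`: `BondTouches (Ω j) x μ`), `covGradNorm` (`|∇^η_{U₀}A|_(α)`: all components `(D^η_{U₀,κ}A_τ)(y)` of the forward
  covariant gradient (1.1), `B8Ineq132.covDerivFwd`, attached to the bond `⟨y, y + e_τ⟩`);
* the dictionary lemmas `bondNorm_le_of_pointwise` / `pointwise_of_bondNorm_le` between the norm form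
  `|A|_(−n) ≤ c` and the printed pointwise form `‖A_b‖ ≤ c(Lʲη)^{−n}` for `b ∈ Ω_j`, `j ≤ k` ((1.41) ↔ `|A|_(−1) ≤ α₂`),
  and `jNorm3`/`gradNorm2`-compatibility is NOT claimed (those are global one-level suprema).

DICTIONARY / HONEST SCOPE.  `T_η` ↦ `ℤᵈ` with explicit spacing `η > 0` and block size `L` (as in `B8Ineq132.InAk`);
a real `iSup` is `0` on an unbounded family, so every lemma producing a lower bound carries a boundedness
hypothesis, exactly as `B8Eq155JBound.wsup`; print's strict "<" pointwise bounds give "≤" for the supremum and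
conversely a strict bound on the supremum gives strict pointwise bounds (`norm_lt_of_msup_lt`).  The admissibility
conditions (1.3)–(1.4) on `{Ω_j}` are not needed for the definition and are not assumed.  Nothing here is new
mathematics; the value is the typed multi-level norm that the statement rows B8-C07, C11, D01, D09–D12, S5, S8 of
the skeleton quantify over.
-/

noncomputable section

open scoped BigOperators
open NormedSpace

namespace Literature.MathematicalPhysics.QuantumFieldTheory.Balaban1983to89.B8ScaledSupNorm

open B7Prop1Explicit
open B8Ineq132 (covDerivFwd BondTouches)

-- `Site` alone would resolve to the torus sites of `Setup.lean`; re-export the `ℤ^d` sites of `B7Prop1Explicit`.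
export B7Prop1Explicit (Site)

/-! ## §1 The scale weight `(Lʲη)^{−α}` -/

section Weight

/-- The scale weight of level `j`: `(Lʲη)^{−α}` (real exponent `α`; print p. 86 «(Lʲη)^{−α}», [4] (3.41)).
[cite: Balaban1985RegularSpaces, p.86 (definition after (1.55))] -/
def weight (L : ℕ) (η α : ℝ) (j : ℕ) : ℝ := (((L : ℝ) ^ j * η) ^ (-α))

/-- The scale length `Lʲη` of the printed weight is positive for `L ≥ 1`, `η > 0` (API of the p. 86 definition).
[cite: Balaban1985RegularSpaces, p.86 (definition after (1.55))] -/
theorem scale_pos {L : ℕ} (hL : 1 ≤ L) {η : ℝ} (hη : 0 < η) (j : ℕ) : 0 < (L : ℝ) ^ j * η :=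
  mul_pos (pow_pos (by exact_mod_cast hL) j) hη

/-- The printed weight `(Lʲη)^{−α}` is positive for `L ≥ 1`, `η > 0` (API of the p. 86 definition).
[cite: Balaban1985RegularSpaces, p.86 (definition after (1.55))] -/
theorem weight_pos {L : ℕ} (hL : 1 ≤ L) {η : ℝ} (hη : 0 < η) (α : ℝ) (j : ℕ) : 0 < weight L η α j :=
  Real.rpow_pos_of_pos (scale_pos hL hη j) _

/-- The printed weight `(Lʲη)^{−α}` is non-negative whenever `η ≥ 0` (API of the p. 86 definition).
[cite: Balaban1985RegularSpaces, p.86 (definition after (1.55))] -/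
theorem weight_nonneg (L : ℕ) {η : ℝ} (hη : 0 ≤ η) (α : ℝ) (j : ℕ) : 0 ≤ weight L η α j :=
  Real.rpow_nonneg (mul_nonneg (pow_nonneg (Nat.cast_nonneg _) j) hη) _

/-- For the exponents of B8, `α = −n` (`n = 1, 2, 3`): `(Lʲη)^{−(−n)} = (Lʲη)ⁿ`, e.g. `|J|_(−3) = sup (Lʲη)³|J|`
((1.55) p. 86). [cite: Balaban1985RegularSpaces, (1.55) p.86] -/
theorem weight_neg_natCast (L : ℕ) (η : ℝ) (n j : ℕ) :
    weight L η (-(n : ℝ)) j = ((L : ℝ) ^ j * η) ^ n := by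
  simp [weight, Real.rpow_natCast]

/-- `α = 0`: unweighted supremum (`|λ|`, (1.102) p. 93). [cite: Balaban1985RegularSpaces, (1.102) p.93] -/
theorem weight_zero (L : ℕ) (η : ℝ) (j : ℕ) : weight L η 0 j = 1 := by
  simp [weight]

/-- The product `(Lʲη)^{−α}·(Lʲη)^{α}` is `1` (`L ≥ 1`, `η > 0`): converts the norm form `(Lʲη)^{−α}‖F‖ ≤ c` of
p. 86 into the pointwise form `‖F‖ ≤ c·(Lʲη)^{α}` «on Ω_j» of (1.41)/(1.62) (API of the p. 86 definition).
[cite: Balaban1985RegularSpaces, p.86 (definition after (1.55))] -/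
theorem weight_mul_rpow {L : ℕ} (hL : 1 ≤ L) {η : ℝ} (hη : 0 < η) (α : ℝ) (j : ℕ) :
    weight L η α j * ((L : ℝ) ^ j * η) ^ α = 1 := by
  unfold weight
  rw [← Real.rpow_add (scale_pos hL hη j), neg_add_cancel, Real.rpow_zero]

end Weight

/-! ## §2 The multi-level weighted supremum `|F|_(α) = sup_{j ≤ k} sup_{Ω_j} (Lʲη)^{−α}‖F‖` -/

section MSup

variable {E : Type*} [SeminormedAddCommGroup E] {ι : Type*}

/-- The index set of the double supremum: pairs `(j, i)` with `j ≤ k` and `i` belonging to `Ω_j`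
(`mem j i`). [cite: Balaban1985RegularSpaces, p.86 (definition after (1.55))] -/
def Idx (k : ℕ) (mem : ℕ → ι → Prop) : Type _ := {p : ℕ × ι // p.1 ≤ k ∧ mem p.1 p.2}

/-- **Print p. 86** «|A|_(α) = sup_j sup_{Ω_j} (Lʲη)^{−α}|A|» for a family `F : ι → E` of values attached to
lattice objects `i : ι`, the levels `j = 0, …, k` of the domain sequence (1.3) and the membership predicate
`mem j i` = "`i` belongs to `Ω_j`" (p. 77 convention).  A real `iSup` (value `0` if the weighted family is
unbounded or the index set is empty). [cite: Balaban1985RegularSpaces, p.86 (definition after (1.55))] -/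
def msup (L k : ℕ) (η α : ℝ) (mem : ℕ → ι → Prop) (F : ι → E) : ℝ :=
  ⨆ p : Idx k mem, weight L η α p.1.1 * ‖F p.1.2‖

/-- A pointwise bound `(Lʲη)^{−α}‖F i‖ ≤ c` for all `i` in `Ω_j`, `j ≤ k` (with `c ≥ 0`) bounds the norm:
`|F|_(α) ≤ c`. [cite: Balaban1985RegularSpaces, p.86 (definition after (1.55))] -/
theorem msup_le {L k : ℕ} {η α : ℝ} {mem : ℕ → ι → Prop} {F : ι → E} {c : ℝ} (hc : 0 ≤ c)
    (h : ∀ j ≤ k, ∀ i, mem j i → weight L η α j * ‖F i‖ ≤ c) : msup L k η α mem F ≤ c :=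
  Real.iSup_le (fun p => h p.1.1 p.2.1 p.1.2 p.2.2) hc

/-- The p. 86 norm `|F|_(α)` is non-negative (`η ≥ 0`) (API of the printed definition; real `iSup` convention).
[cite: Balaban1985RegularSpaces, p.86 (definition after (1.55))] -/
theorem msup_nonneg (L k : ℕ) {η : ℝ} (hη : 0 ≤ η) (α : ℝ) (mem : ℕ → ι → Prop) (F : ι → E) :
    0 ≤ msup L k η α mem F :=
  Real.iSup_nonneg fun p => mul_nonneg (weight_nonneg L hη α p.1.1) (norm_nonneg _)

/-- Boundedness of the weighted family `(Lʲη)^{−α}‖F‖` on `⋃_{j ≤ k} Ω_j` — the side condition under which the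
printed `sup_j sup_{Ω_j}` of p. 86 is attained by the real `iSup` (finite lattices in print; explicit here).
[cite: Balaban1985RegularSpaces, p.86 (definition after (1.55))] -/
def Bdd (L k : ℕ) (η α : ℝ) (mem : ℕ → ι → Prop) (F : ι → E) : Prop :=
  ∃ c : ℝ, ∀ j ≤ k, ∀ i, mem j i → weight L η α j * ‖F i‖ ≤ c

/-- A uniform pointwise bound on `⋃_{j ≤ k} Ω_j` witnesses the boundedness side condition of the p. 86 supremum.
[cite: Balaban1985RegularSpaces, p.86 (definition after (1.55))] -/
theorem bdd_of_forall {L k : ℕ} {η α : ℝ} {mem : ℕ → ι → Prop}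
    {F : ι → E} {c : ℝ} (h : ∀ j ≤ k, ∀ i, mem j i → weight L η α j * ‖F i‖ ≤ c) : Bdd L k η α mem F :=
  ⟨c, h⟩

/-- Each weighted member is below the norm (for a bounded family): `(Lʲη)^{−α}‖F i‖ ≤ |F|_(α)` for `i` in `Ω_j`,
`j ≤ k`. [cite: Balaban1985RegularSpaces, p.86 (definition after (1.55))] -/
theorem weight_mul_norm_le_msup {L k : ℕ} {η α : ℝ} {mem : ℕ → ι → Prop} {F : ι → E}
    (hB : Bdd L k η α mem F) {j : ℕ} (hj : j ≤ k) {i : ι} (hi : mem j i) :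
    weight L η α j * ‖F i‖ ≤ msup L k η α mem F := by
  obtain ⟨c, hc⟩ := hB
  have hbdd : BddAbove (Set.range fun p : Idx k mem => weight L η α p.1.1 * ‖F p.1.2‖) := by
    refine ⟨c, ?_⟩
    rintro _ ⟨p, rfl⟩
    exact hc p.1.1 p.2.1 p.1.2 p.2.2
  exact le_ciSup hbdd (⟨(j, i), hj, hi⟩ : Idx k mem)

/-- From the norm back to print's pointwise form: `|F|_(α) ≤ c` gives `‖F i‖ ≤ c·(Lʲη)^{α}` on `Ω_j`, `j ≤ k`
(e.g. `|A|_(−1) ≤ α₂` ⇒ `‖A_b‖ ≤ α₂(Lʲη)^{−1}`, the shape of (1.41) p. 83), for a bounded family, `L ≥ 1`, `η > 0`.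
[cite: Balaban1985RegularSpaces, (1.41) p.83; p.86 (definition after (1.55))] -/
theorem norm_le_of_msup_le {L k : ℕ} (hL : 1 ≤ L) {η : ℝ} (hη : 0 < η) {α : ℝ} {mem : ℕ → ι → Prop}
    {F : ι → E} (hB : Bdd L k η α mem F) {c : ℝ} (hc : msup L k η α mem F ≤ c) {j : ℕ} (hj : j ≤ k) {i : ι}
    (hi : mem j i) : ‖F i‖ ≤ c * ((L : ℝ) ^ j * η) ^ α := by
  have h1 : weight L η α j * ‖F i‖ ≤ c := (weight_mul_norm_le_msup hB hj hi).trans hc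
  have hs : 0 < ((L : ℝ) ^ j * η) ^ α := Real.rpow_pos_of_pos (scale_pos hL hη j) _
  have h2 := mul_le_mul_of_nonneg_right h1 hs.le
  calc ‖F i‖ = weight L η α j * ‖F i‖ * ((L : ℝ) ^ j * η) ^ α := by
        rw [mul_comm (weight L η α j), mul_assoc, weight_mul_rpow hL hη α j, mul_one]
    _ ≤ c * ((L : ℝ) ^ j * η) ^ α := h2

/-- Strict version, the direction print uses in (1.102)/(1.108)–(1.109) pp. 93–94 («{λ: |λ|, |Dλ|_(−1) < βα₄}»
read pointwise «|λ| < βα₄, |Dλ| < βα₄(Lʲη)^{−1} on Ω_j»): `|F|_(α) < c` gives `‖F i‖ < c·(Lʲη)^{α}` on `Ω_j`.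
[cite: Balaban1985RegularSpaces, (1.102) p.93] -/
theorem norm_lt_of_msup_lt {L k : ℕ} (hL : 1 ≤ L) {η : ℝ} (hη : 0 < η) {α : ℝ} {mem : ℕ → ι → Prop}
    {F : ι → E} (hB : Bdd L k η α mem F) {c : ℝ} (hc : msup L k η α mem F < c) {j : ℕ} (hj : j ≤ k) {i : ι}
    (hi : mem j i) : ‖F i‖ < c * ((L : ℝ) ^ j * η) ^ α := by
  have h1 : weight L η α j * ‖F i‖ < c := (weight_mul_norm_le_msup hB hj hi).trans_lt hc
  have hs : 0 < ((L : ℝ) ^ j * η) ^ α := Real.rpow_pos_of_pos (scale_pos hL hη j) _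
  have h2 := mul_lt_mul_of_pos_right h1 hs
  calc ‖F i‖ = weight L η α j * ‖F i‖ * ((L : ℝ) ^ j * η) ^ α := by
        rw [mul_comm (weight L η α j), mul_assoc, weight_mul_rpow hL hη α j, mul_one]
    _ < c * ((L : ℝ) ^ j * η) ^ α := h2

/-- Print's pointwise form implies the norm bound: if `‖F i‖ ≤ c·(Lʲη)^{α}` for all `i` in `Ω_j`, `j ≤ k`
(`c ≥ 0`, `L ≥ 1`, `η > 0`), then `|F|_(α) ≤ c`. [cite: Balaban1985RegularSpaces, p.86 (definition after (1.55))] -/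
theorem msup_le_of_pointwise {L k : ℕ} (hL : 1 ≤ L) {η : ℝ} (hη : 0 < η) {α : ℝ} {mem : ℕ → ι → Prop}
    {F : ι → E} {c : ℝ} (hc : 0 ≤ c) (h : ∀ j ≤ k, ∀ i, mem j i → ‖F i‖ ≤ c * ((L : ℝ) ^ j * η) ^ α) :
    msup L k η α mem F ≤ c := by
  refine msup_le hc fun j hj i hi => ?_
  have hw : 0 ≤ weight L η α j := (weight_pos hL hη α j).le
  calc weight L η α j * ‖F i‖ ≤ weight L η α j * (c * ((L : ℝ) ^ j * η) ^ α) :=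
        mul_le_mul_of_nonneg_left (h j hj i hi) hw
    _ = c * (weight L η α j * ((L : ℝ) ^ j * η) ^ α) := by ring
    _ = c := by rw [weight_mul_rpow hL hη α j, mul_one]

/-- Monotonicity of the p. 86 norm in the domain sequence (1.3): shrinking every `Ω_j` (or lowering `k`) does not
increase `sup_{j ≤ k} sup_{Ω_j} (Lʲη)^{−α}‖F‖` (bounded family on the larger index set) — the mechanism of p. 88
«they hold for k − 1, if they hold for k». [cite: Balaban1985RegularSpaces, p.86 (definition after (1.55)); p.88 (before Thm 4)] -/
theorem msup_mono_mem {L k k' : ℕ} (hk : k' ≤ k) {η : ℝ} (hη : 0 ≤ η) {α : ℝ} {mem mem' : ℕ → ι → Prop}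
    (hmem : ∀ j i, mem' j i → mem j i) {F : ι → E} (hB : Bdd L k η α mem F) :
    msup L k' η α mem' F ≤ msup L k η α mem F :=
  Real.iSup_le (fun p => weight_mul_norm_le_msup hB (p.2.1.trans hk) (hmem _ _ p.2.2))
    (msup_nonneg L k hη α mem F)

end MSup

/-! ## §3 The instances on the `ℤᵈ` carriers: site functions, bond functions, the covariant gradient -/

section Lattice

variable {d : ℕ} {E : Type*} [SeminormedAddCommGroup E]

/-- `|λ|_(α)` for a SITE function `λ : Site d → E` (gauge parameters `λ`, sources `f` of (1.146)): membership
`x ∈ Ω_j`. [cite: Balaban1985RegularSpaces, p.86 (definition after (1.55)); (1.102) p.93; Thm 8 p.101] -/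
def siteNorm (L k : ℕ) (η α : ℝ) (Ω : ℕ → Set (Site d)) (lam : Site d → E) : ℝ :=
  msup L k η α (fun j (x : Site d) => x ∈ Ω j) lam

/-- `|A|_(α)` for a BOND function `A : Site d → Fin d → E` (`A`, `J = D^{η*}D^ηA`, `Dλ`): the bond `⟨x, x + e_μ⟩`
belongs to `Ω_j` iff one of its end-points does (p. 77, `B8Ineq132.BondTouches`).
[cite: Balaban1985RegularSpaces, p.86 (definition after (1.55)); p.77 (convention before (1.5))] -/
def bondNorm (L k : ℕ) (η α : ℝ) (Ω : ℕ → Set (Site d)) (A : Site d → Fin d → E) : ℝ :=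
  msup L k η α (fun j (b : Site d × Fin d) => BondTouches (Ω j) b.1 b.2) (fun b => A b.1 b.2)

variable {𝔸 : Type*} [NormedRing 𝔸] [NormedAlgebra ℂ 𝔸]

/-- `|∇^η_{U₀}A|_(α)`: the norm of the forward covariant gradient (1.1) of a bond function — all components
`(D^η_{U₀,κ}A_τ)(y)` (`B8Ineq132.covDerivFwd`, as in `B8Eq155JBound.gradNorm2`), attached to the bond `⟨y, y + e_τ⟩`
of `A_τ`. [cite: Balaban1985RegularSpaces, (1.1) p.76; (1.59) p.86] -/
def covGradNorm (L k : ℕ) (η α : ℝ) (Ω : ℕ → Set (Site d)) (U₀ : Site d → Fin d → 𝔸ˣ)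
    (A : Site d → Fin d → 𝔸) : ℝ :=
  msup L k η α (fun j (t : Fin d × Fin d × Site d) => BondTouches (Ω j) t.2.2 t.2.1)
    (fun t => covDerivFwd η U₀ t.1 (fun z => A z t.2.1) t.2.2)

/-- DICTIONARY (pointwise ⇒ norm): print's «|A| < c(Lʲη)^{−n} on Ω_j, j = 0, …, k» (e.g. (1.41) with `n = 1`,
`c = α₂`) gives `|A|_(−n) ≤ c` (`L ≥ 1`, `η > 0`, `c ≥ 0`). [cite: Balaban1985RegularSpaces, (1.41) p.83; p.86] -/
theorem bondNorm_le_of_pointwise {L k : ℕ} (hL : 1 ≤ L) {η : ℝ} (hη : 0 < η) (n : ℕ) {Ω : ℕ → Set (Site d)}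
    {A : Site d → Fin d → E} {c : ℝ} (hc : 0 ≤ c)
    (h : ∀ j ≤ k, ∀ x μ, BondTouches (Ω j) x μ → ‖A x μ‖ ≤ c * (((L : ℝ) ^ j * η) ^ n)⁻¹) :
    bondNorm L k η (-(n : ℝ)) Ω A ≤ c := by
  refine msup_le_of_pointwise hL hη hc fun j hj b hb => ?_
  have e : ((L : ℝ) ^ j * η) ^ (-(n : ℝ)) = (((L : ℝ) ^ j * η) ^ n)⁻¹ := by
    rw [Real.rpow_neg (scale_pos hL hη j).le, Real.rpow_natCast]
  rw [e]
  exact h j hj b.1 b.2 hb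

/-- DICTIONARY (norm ⇒ pointwise): `|A|_(−n) ≤ c` gives back «‖A_b‖ ≤ c(Lʲη)^{−n} for b ∈ Ω_j, j ≤ k», for a
family bounded in the sense of `Bdd` (automatic when the pointwise bound holds, `bdd_of_forall`).
[cite: Balaban1985RegularSpaces, (1.41) p.83; p.86] -/
theorem pointwise_of_bondNorm_le {L k : ℕ} (hL : 1 ≤ L) {η : ℝ} (hη : 0 < η) (n : ℕ) {Ω : ℕ → Set (Site d)}
    {A : Site d → Fin d → E}
    (hB : Bdd L k η (-(n : ℝ)) (fun j (b : Site d × Fin d) => BondTouches (Ω j) b.1 b.2) fun b => A b.1 b.2)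
    {c : ℝ} (hc : bondNorm L k η (-(n : ℝ)) Ω A ≤ c) {j : ℕ} (hj : j ≤ k) {x : Site d} {μ : Fin d}
    (hx : BondTouches (Ω j) x μ) : ‖A x μ‖ ≤ c * (((L : ℝ) ^ j * η) ^ n)⁻¹ := by
  have h := norm_le_of_msup_le hL hη hB hc hj (i := (x, μ)) hx
  have e : ((L : ℝ) ^ j * η) ^ (-(n : ℝ)) = (((L : ℝ) ^ j * η) ^ n)⁻¹ := by
    rw [Real.rpow_neg (scale_pos hL hη j).le, Real.rpow_natCast]
  simpa [e] using h

/-- The site version of the dictionary: «|λ| < c on Ω_j» / «|f| ≤ c(Lʲη)^{−n} on Ω_j» ⇒ `|·|_(−n) ≤ c`.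
[cite: Balaban1985RegularSpaces, (1.102) p.93; Thm 8 p.101] -/
theorem siteNorm_le_of_pointwise {L k : ℕ} (hL : 1 ≤ L) {η : ℝ} (hη : 0 < η) (n : ℕ) {Ω : ℕ → Set (Site d)}
    {lam : Site d → E} {c : ℝ} (hc : 0 ≤ c)
    (h : ∀ j ≤ k, ∀ x ∈ Ω j, ‖lam x‖ ≤ c * (((L : ℝ) ^ j * η) ^ n)⁻¹) :
    siteNorm L k η (-(n : ℝ)) Ω lam ≤ c := by
  refine msup_le_of_pointwise hL hη hc fun j hj x hx => ?_
  have e : ((L : ℝ) ^ j * η) ^ (-(n : ℝ)) = (((L : ℝ) ^ j * η) ^ n)⁻¹ := by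
    rw [Real.rpow_neg (scale_pos hL hη j).le, Real.rpow_natCast]
  rw [e]
  exact h j hj x hx

/-- The zero bond function has p. 86 norm `0` for every exponent `α` and every domain sequence (sanity instance of
the printed definition). [cite: Balaban1985RegularSpaces, p.86 (definition after (1.55))] -/
theorem bondNorm_zero (L k : ℕ) (η α : ℝ) (Ω : ℕ → Set (Site d)) :
    bondNorm L k η α Ω (0 : Site d → Fin d → E) = 0 := by
  simp [bondNorm, msup]

end Lattice

end Literature.MathematicalPhysics.QuantumFieldTheory.Balaban1983to89.B8ScaledSupNorm
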